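import Summits.RiemannHypothesis.RiemannHypothesis.Theorems.WeilFormatCDataRungGenericA
import Summits.RiemannHypothesis.RiemannHypothesis.Theorems.WeilFormatCDataKitG
import Literature.NumberTheory.LFunctions.YoshidaWindowGramFrontDoorA
import HarnessLib

/-!
# Format C: the KERNEL front door with a CERTIFIED prime constant — data kit for `weilPositivityOn_of_formatC_kernelsA`

Helper file of the rh-explicit Weil-positivity programme (`--supports stmt-RiemannHypothesis-0098`; seat
rh-explicit-weil-2 gen6), RH-free, no definitions, no named facts.  It is `weilPositivityOn_of_kitG`
(`WeilFormatCDataKitG.lean`) VERBATIM over weil-1's parametrised door `WeilFormatC.weilPositivityOn_of_formatC_kernelsA`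
(`WeilFormatCDataRungGenericA.lean`): the far diagonals carry `A/2` for a certified prime constant `A` (hypothesis `hPA`,
the statement shape of `WeilFormatC.primeCoeff_form_ge_cells_one_v2` — `A = 2027/1000` on `a ≤ 1` — instead of the
path-graph `A_op⁺(a)/2`), and the front-door constants record is read under `Encl.FDValidA S a A F` (Literature part X,
`YoshidaWindowGramFrontDoorA.lean`: the `Aop` field encloses `A`; a rung writes `F := {F₀ with Aop := MI.ofFrac S p q}` and
gets `FDValidA` from `FDValid.withFrac`).  Every `decide +kernel` certificate of a rung (`devEvenBox`/`devOddBox` endpoints,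
`checkWeightsOdd`, the two `near` enclosures, the two `PsdDyadic.checkPsdMid` verdicts) is textually the same as for
`_kitG`; the tail enters only through `U2E`/`U2O` and their majorant premises (`U2EvenJ_majorant`, `U2EvenJMS_majorant`, …,
unchanged).

* `devEvenA_mono`, `devOdd0A_mono` — monotonicity of the parametrised far diagonals in the mode;
* `weilPositivityOn_of_kitGA` — the kit.
-/

set_option linter.dupNamespace false
set_option autoImplicit false

noncomputable section

open Complex Finset Matrix
open scoped Real BigOperators ComplexConjugate ArithmeticFunction.vonMangoldt

namespace Summit.RiemannHypothesis.RiemannHypothesis.Theorems.WeilFormatC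

open Literature.NumberTheory.LFunctions Literature.NumberTheory.LFunctions.Yoshida1992
  Literature.NumberTheory.LFunctions.Yoshida1992.Encl Literature.Analysis.SpecialFunctions
  Literature.Analysis.ValidatedNumerics.NumericsMP

variable {a : ℝ} {S : ℕ} {ks : List PrimeLen} {C : Consts} {F : FDConsts}

/-- Monotonicity of the parametrised even far diagonal `d̂⁺_A` in the mode (from `even_dhat_core_mono`). -/
theorem devEvenA_mono (ha : 0 < a) (A : ℝ) {Be m : ℕ} (hBe : 1 ≤ Be) (hm : Be ≤ m) :
    devEvenA a A Be Be ≤ devEvenA a A Be m := by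
  have hC : 0 ≤ a * (1 + weilArchDensity (2 * a)) := by
    have := weilArchDensity_pos (show 0 < 2 * a by positivity); positivity
  have h := even_dhat_core_mono ha hC hBe hm
  unfold devEvenA
  linarith

/-- Monotonicity of the parametrised odd far-diagonal core minus `π/4` (from `odd_dhat_core_mono`). -/
theorem devOdd0A_mono (ha : 0 < a) (A : ℝ) {Bo l : ℕ} (hl : Bo ≤ l) : devOdd0A a A Bo Bo ≤ devOdd0A a A Bo l := by
  have hC : 0 ≤ a * (1 + weilArchDensity (2 * a)) := by
    have := weilArchDensity_pos (show 0 < 2 * a by positivity); positivity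
  have h := odd_dhat_core_mono ha hC hl
  unfold devOdd0A
  linarith

/-- **`WeilPositivityOn a` from the GENERIC data kit with a CERTIFIED prime constant `A`.**  As `weilPositivityOn_of_kitG`,
over `weilPositivityOn_of_formatC_kernelsA ha hPA`: all hypotheses except `hPA` and the tail majorant premises `hU2E`/`hU2O`
are delivered by `decide +kernel` certificates of the generated rung files (validity of constants / front-door constants read
under `FDValidA S a A F` / prime data / tables, the two `near` enclosures against the chosen tail `U2E`/`U2O`, the odd column
weights, the two `PsdDyadic` verdicts) or are integer comparisons of box endpoints. -/
theorem weilPositivityOn_of_kitGA (ha : 0 < a)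
    {A : ℝ} (hPA : ∀ (s : Finset ℤ) (c : ℤ → ℂ),
      -(A * ∑ n ∈ s, ‖c n‖ ^ 2) ≤ ∑ n ∈ s, ∑ m ∈ s, (conj (c n) * c m).re * primeCoeff a n m)
    (hS : 0 < S) (hC : ConstsValid S a ks C) (hF : FDValidA S a A F) {tab : List IdxRec}
    -- EVEN sector
    {Be B3e : ℕ} (hBe : 2 ≤ Be) (hBBe : Be ≤ B3e) (hTe : TabValid S a ks (Be + 1) tab) {ctabE : List IdxRec}
    (hCTe : TabColValid S a ks Be (B3e + 1) ctabE)
    {ce cde wze d0ze pe qe : ℕ} (hwze : 0 < wze) (hd0ze : 0 < d0ze) (hsqe : checkSqrtUpper 8 (Be - 1) pe qe = true)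
    (h0e : 0 < (devEvenBox S C F (tget tab Be) Be pe qe).lo)
    (hwe : (wze : ℤ) * (S : ℤ) ≤ (devEvenBox S C F (tget tab Be) Be pe qe).lo * 2 ^ cde)
    (hd0e : (d0ze : ℤ) * (S : ℤ) ≤ (devEvenBox S C F (tget ctabE B3e) B3e pe qe).lo * 2 ^ cde)
    (U2E : ℕ → ℕ → ℝ)
    (hU2E : ∀ d : ℕ → ℝ, (∀ m, B3e ≤ m → (d0ze : ℝ) * (1 / 2 ^ cde) ≤ d m) → ∀ (N : ℕ) (x : Fin Be → ℝ),
      ∑ m ∈ Finset.Ico B3e N, (∑ i : Fin Be, (if (i : ℕ) = 0 then gramCoeff a 0 m else if m = 0 then gramCoeff a i 0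
        else (gramCoeff a i m + gramCoeff a i (-(m : ℤ))) / 2) * x i) ^ 2 / d m
        ≤ x ⬝ᵥ (Matrix.of fun i j : Fin Be ↦ U2E i j) *ᵥ x)
    {ρe δe : ℤ} {DSe Le : List (List ℤ)} (hPe : PsdDyadic.checkPsdMid Be δe ρe DSe Le = true)
    (hneare : ∀ i j : Fin Be,
      |((if (i : ℕ) = 0 then gramCoeff a 0 j else if (j : ℕ) = 0 then gramCoeff a i 0
          else (gramCoeff a i j + gramCoeff a i (-(j : ℤ))) / 2)
        - (∑ m ∈ Finset.Ico Be B3e, (if (i : ℕ) = 0 then gramCoeff a 0 m else if m = 0 then gramCoeff a i 0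
            else (gramCoeff a i m + gramCoeff a i (-(m : ℤ))) / 2) *
            (if (j : ℕ) = 0 then gramCoeff a 0 m else if m = 0 then gramCoeff a j 0
            else (gramCoeff a j m + gramCoeff a j (-(m : ℤ))) / 2) / ((fun _ : ℕ ↦ (wze : ℝ) * (1 / 2 ^ cde)) m))
        - U2E i j)
        - (PsdDyadic.getMZ DSe i j : ℝ) * (1 / 2 ^ ce)| ≤ (ρe : ℝ) * (1 / 2 ^ ce))
    -- ODD sector
    {Bo B3o : ℕ} (hBo : 1 ≤ Bo) (hBBo : Bo ≤ B3o) {ctabO : List IdxRec}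
    (hCTo : TabColValid S a ks Bo (B3o + 2) ctabO)
    {co cdo d0zo po qo Ksero qr : ℕ} {wso rso : List ℕ} (hd0zo : 0 < d0zo) (hsqo : checkSqrtUpper 8 Bo po qo = true)
    (h0o : 0 < (devOddBox S C F (tget ctabO (Bo + 1)) Bo Bo po qo).lo)
    (hWo : checkWeightsOdd S Ksero C F ctabO Bo (B3o - Bo) cdo wso rso qr po qo = true)
    (hd0o : (d0zo : ℤ) * (S : ℤ) ≤ (devOddBox S C F (tget ctabO (B3o + 1)) B3o Bo po qo).lo * 2 ^ cdo)
    (U2O : ℕ → ℕ → ℝ)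
    (hU2O : ∀ d : ℕ → ℝ, (∀ l, B3o ≤ l → (d0zo : ℝ) * (1 / 2 ^ cdo) ≤ d l) → ∀ (N : ℕ) (x : Fin Bo → ℝ),
      ∑ l ∈ Finset.Ico B3o N, (∑ k : Fin Bo, ((gramCoeff a (((k : ℕ) : ℤ) + 1) ((l : ℤ) + 1)
        - gramCoeff a (((k : ℕ) : ℤ) + 1) (-((l : ℤ) + 1))) / 2) * x k) ^ 2 / d l
        ≤ x ⬝ᵥ (Matrix.of fun k k' : Fin Bo ↦ U2O k k') *ᵥ x)
    {ρo δo : ℤ} {DSo Lo : List (List ℤ)} (hPo : PsdDyadic.checkPsdMid Bo δo ρo DSo Lo = true)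
    (hnearo : ∀ k k' : Fin Bo,
      |(((gramCoeff a (((k : ℕ) : ℤ) + 1) (((k' : ℕ) : ℤ) + 1) - gramCoeff a (((k : ℕ) : ℤ) + 1) (-(((k' : ℕ) : ℤ) + 1))) / 2)
        - (∑ l ∈ Finset.Ico Bo B3o, ((gramCoeff a (((k : ℕ) : ℤ) + 1) ((l : ℤ) + 1) - gramCoeff a (((k : ℕ) : ℤ) + 1) (-((l : ℤ) + 1))) / 2) *
            ((gramCoeff a (((k' : ℕ) : ℤ) + 1) ((l : ℤ) + 1) - gramCoeff a (((k' : ℕ) : ℤ) + 1) (-((l : ℤ) + 1))) / 2) /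
              (woF wso cdo Bo l))
        - U2O k k')
        - (PsdDyadic.getMZ DSo k k' : ℝ) * (1 / 2 ^ co)| ≤ (ρo : ℝ) * (1 / 2 ^ co)) :
    WeilPositivityOn a := by
  have hSr : (0 : ℝ) < S := by exact_mod_cast hS
  -- EVEN numeric facts
  have hBe1 : 1 ≤ Be := by omega
  have hreBe : MI.mem S (reDigammaQuarter (freq a Be)) (tget tab Be).reP := (hTe Be (by omega)).2.reP
  have hreB3e : MI.mem S (reDigammaQuarter (freq a B3e)) (tget ctabE B3e).reP := (hCTe B3e (by omega) (by omega)).2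
  have hloBe := devEvenBox_lo_le_A hS ha hC hF hreBe (by omega) hsqe
  have hloB3e := devEvenBox_lo_le_A hS ha hC hF hreB3e (by omega) hsqe
  have h0e' : 0 < devEvenA a A Be Be := by
    have : (0 : ℝ) < (devEvenBox S C F (tget tab Be) Be pe qe).lo := by exact_mod_cast h0e
    nlinarith
  have hwe' : (wze : ℝ) * (1 / 2 ^ cde) ≤ devEvenA a A Be Be := dyadic_le_of_lo hS hwe hloBe
  have hd0e' : (d0ze : ℝ) * (1 / 2 ^ cde) ≤ devEvenA a A Be B3e := dyadic_le_of_lo hS hd0e hloB3e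
  have hwpos : (0 : ℝ) < (wze : ℝ) * (1 / 2 ^ cde) := by positivity
  have hd0pos : (0 : ℝ) < (d0ze : ℝ) * (1 / 2 ^ cde) := by positivity
  -- ODD numeric facts
  have hreBo : MI.mem S (reDigammaQuarter (freq a ((Bo : ℤ) + 1))) (tget ctabO (Bo + 1)).reP := by
    have h := (hCTo (Bo + 1) (by omega) (by omega)).2
    push_cast at h; exact h
  have hreB3o : MI.mem S (reDigammaQuarter (freq a ((B3o : ℤ) + 1))) (tget ctabO (B3o + 1)).reP := by
    have h := (hCTo (B3o + 1) (by omega) (by omega)).2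
    push_cast at h; exact h
  have hloBo := devOddBox_lo_le_A hS ha hC hF hreBo (by omega) hsqo
  have hloB3o := devOddBox_lo_le_A hS ha hC hF hreB3o (by omega) hsqo
  have h0o' : 0 < devOdd0A a A Bo Bo := by
    have : (0 : ℝ) < (devOddBox S C F (tget ctabO (Bo + 1)) Bo Bo po qo).lo := by exact_mod_cast h0o
    nlinarith
  have hd0o' : (d0zo : ℝ) * (1 / 2 ^ cdo) ≤ devOdd0A a A Bo B3o := dyadic_le_of_lo hS hd0o hloB3o
  have hd0opos : (0 : ℝ) < (d0zo : ℝ) * (1 / 2 ^ cdo) := by positivity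
  have hWts := weights_of_checkOdd_A hS ha hC hF (by omega) hsqo hCTo (by omega) hWo
  refine weilPositivityOn_of_formatC_kernelsA ha hPA hBe hBBe (d0e := (d0ze : ℝ) * (1 / 2 ^ cde))
    (fun _ ↦ (wze : ℝ) * (1 / 2 ^ cde)) ?_ ?_ ?_ (Matrix.of fun i j : Fin Be ↦ U2E i j) hU2E ?_
    hBo hBBo (d0o := (d0zo : ℝ) * (1 / 2 ^ cdo)) (woF wso cdo Bo) ?_ ?_ ?_ (Matrix.of fun k k' : Fin Bo ↦ U2O k k') hU2O ?_
  · -- h0e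
    have h := h0e'; unfold devEvenA at h; exact h
  · -- hd0e
    refine ⟨hd0pos, ?_⟩
    have h := hd0e'; unfold devEvenA at h; exact h
  · -- hwe
    intro m hm _
    refine ⟨hwpos, ?_⟩
    have h := hwe'.trans (devEvenA_mono ha A hBe1 hm)
    unfold devEvenA at h; exact h
  · -- hSe
    intro x
    have hP := PsdDyadic.psd_of_checkPsdMid hPe (u := 1 / 2 ^ ce) (by positivity) _ (fun i j ↦ hneare i j) x
    simpa only [Matrix.of_apply] using hP
  · -- h0o
    have h := h0o'; unfold devOdd0A at h; exact h
  · -- hd0o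
    refine ⟨hd0opos, ?_⟩
    have h := hd0o'; unfold devOdd0A at h; exact h
  · -- hwo (per column)
    intro l hl hlB
    have h := hWts l hl (by omega)
    unfold devOddAA at h
    exact h
  · -- hSo
    intro x
    have hP := PsdDyadic.psd_of_checkPsdMid hPo (u := 1 / 2 ^ co) (by positivity) _ (fun k k' ↦ hnearo k k') x
    simpa only [Matrix.of_apply] using hP

end Summit.RiemannHypothesis.RiemannHypothesis.Theorems.WeilFormatC

end
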